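import Summits.HodgeConjecture.CorCM.Census.QuaternionEightLaw
import Summits.HodgeConjecture.CorCM.Census.HalfParityCount

/-!
# The quaternion law, base case, counted: `φ₂(Q₈, −1) = 2`, hence `μ(Q₈, −1) = 2` EXACTLY

COR-CM (cell `pub-hodgecm2`), count-neutral kernel combinatorics by the binder seat b09 (gen 38; lane TWO-ADIC SPLITTING +
NONDEGENERATE REDUCTION, part I), sequel of part H `Census/QuaternionEightLaw.lean` (`μ(Q₈, −1) = φ₂(Q₈, −1)`, `eq_rt_T_or_rt_TfA`,
`two_le_fibreTwo`) and of seat b09ʼs closed form `Census/HalfParityCount.lean` (`fibreTwo_add_two_eq_of_even`: `φ₂ + 2 = β + dim 𝔛(G,c)` for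
`|G|/2` even) used BY NAME.  Theorems only: no definition, no named fact, no `sorry`; the finite checks are `decide` over the `8` group elements.
HONEST FRAMING: `HC_CM` is NOT proved, here or anywhere in the tree; nothing here is a period or a headline.

* `card_block_le_two` / `card_block_eq_two`: `β(Q₈, −1) = 2` (every type is a base change of `T` or of `TfA`, and these lie in different blocks);
* `finrank_charK_le_two`: `dim 𝔛(Q₈, −1) ≤ 2` (a stabiliser character is additive, hence determined by its values at `a 1 = i` and `xa 0 = j`);
* `fibreTwo_eq_two`: `φ₂(Q₈, −1) = 2` (`φ₂ + 2 = β + dim 𝔛 ≤ 4` and `φ₂ ≥ 2`);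
* **`isLeast_card_gfaces_generate_two`: `μ(Q₈, −1) = 2`** — EXACTLY two rank-four face relations generate the integer Hodge lattice of a
  quaternion-octic Galois CM type modulo divisor pairs under base change, and no single Hodge generator does (the row `Q₈: β 2, μ 2` of
  André-3ʼs atlas, now a law in the intrinsic currency; seat b30ʼs census certificate `Census/OcticFaceSquaresQuaternion.lean` counts the same in
  the face-square currency).

## References
* [Pohlmann1968] H. Pohlmann, Algebraic cycles on abelian varieties of complex multiplication type, Ann. of Math. 88 (1968), Thm 1.
-/

namespace Summit.HodgeConjecture.CorCM.Census.QuaternionEight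

open Finset QuaternionGroup
open Summit.HodgeConjecture.CorCM.Prior.AllgGroup.RfwfAllgGroup
open Summit.HodgeConjecture.CorCM.Census.BlockParity
open Summit.HodgeConjecture.CorCM.Census.Coinvariant
open Summit.HodgeConjecture.CorCM.Census.HalfParity
open Summit.HodgeConjecture.CorCM.Census.HalfParity.ExampleQ8

noncomputable section

/-- **`β(Q₈, −1) ≤ 2`**: every block is the block of `T` or of `TfA`. [folklore] -/
theorem card_block_le_two : Fintype.card (Block c) ≤ 2 := by
  classical
  let f : Bool → Block c := fun b => if b then blk c T else blk c TfA
  have hf : Function.Surjective f := by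
    intro B
    rcases eq_rt_T_or_rt_TfA B.out with ⟨Q, hQ⟩ | ⟨Q, hQ⟩
    · refine ⟨true, ?_⟩
      show blk c T = B
      rw [← Quotient.out_eq B]
      change blk c T = blk c B.out
      rw [hQ, blk_rt]
    · refine ⟨false, ?_⟩
      show blk c TfA = B
      rw [← Quotient.out_eq B]
      change blk c TfA = blk c B.out
      rw [hQ, blk_rt]
  have h := Fintype.card_le_of_surjective f hf
  rwa [Fintype.card_bool] at h

/-- **`dim 𝔛(Q₈, −1) ≤ 2`**: a stabiliser character is additive, hence determined by its values at `a 1` and `xa 0`. [folklore] -/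
theorem finrank_charK_le_two : Module.finrank (ZMod 2) ↥(charK c) ≤ 2 := by
  let ev : (G → ZMod 2) →ₗ[ZMod 2] (ZMod 2 × ZMod 2) :=
    { toFun := fun χ => (χ (a 1), χ (xa 0)), map_add' := fun _ _ => rfl, map_smul' := fun _ _ => rfl }
  have hinj : Function.Injective (ev ∘ₗ (charK c).subtype) := by
    intro χ₁ χ₂ h
    apply Subtype.ext
    have hsub : ∀ χ : ↥(charK c), χ.1 (a 1) = 0 → χ.1 (xa 0) = 0 → χ.1 = 0 := by
      intro χ h1 h2
      obtain ⟨hadd, -, -⟩ := (mem_charK c χ.1).mp χ.2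
      have h0 : χ.1 1 = 0 := by
        have := hadd 1 1; rw [one_mul] at this
        have key : ∀ x : ZMod 2, x = x + x → x = 0 := by decide
        exact key _ this
      have hpow : ∀ k : ℕ, χ.1 (a 1 ^ k) = 0 := by
        intro k
        induction k with
        | zero => rw [pow_zero]; exact h0
        | succ k ih => rw [pow_succ, hadd, ih, h1, add_zero]
      have ha : ∀ i : ZMod (2 * 2), χ.1 (a i) = 0 := fun i => by
        have h := hpow i.val
        rwa [a_one_pow, ZMod.natCast_zmod_val] at h
      have hxa : ∀ i : ZMod (2 * 2), χ.1 (xa i) = 0 := fun i => by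
        rw [show (xa i : G) = xa 0 * a i by rw [xa_mul_a, zero_add], hadd, h2, ha, add_zero]
      funext g
      rw [Pi.zero_apply]
      cases g with
      | a i => exact ha i
      | xa i => exact hxa i
    -- linear: injective iff kernel trivial
    have hdiff : (χ₁ - χ₂).1 = 0 := by
      have h' : ev (χ₁ - χ₂).1 = 0 := by
        have := congrArg (fun p : ZMod 2 × ZMod 2 => p) h
        rw [Submodule.coe_sub, map_sub, sub_eq_zero]
        exact h
      have e1 : (χ₁ - χ₂).1 (a 1) = 0 := congrArg Prod.fst h'
      have e2 : (χ₁ - χ₂).1 (xa 0) = 0 := congrArg Prod.snd h'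
      exact hsub _ e1 e2
    rw [Submodule.coe_sub, sub_eq_zero] at hdiff
    exact hdiff
  have h := LinearMap.finrank_le_finrank_of_injective hinj
  rwa [Module.finrank_prod, Module.finrank_self] at h

/-- **`φ₂(Q₈, −1) ≤ 2`** (`φ₂ + 2 = β + dim 𝔛 ≤ 2 + 2`). [folklore] -/
theorem fibreTwo_le_two : fibreTwo c c_mul_c ≤ 2 := by
  have h := fibreTwo_add_two_eq_of_even c c_mul_c c_ne_one c_comm (by rw [QuaternionGroup.card]; decide)
  have h1 := card_block_le_two
  have h2 := finrank_charK_le_two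
  omega

/-- **`β(Q₈, −1) = 2`.** [folklore] -/
theorem card_block_eq_two : Fintype.card (Block c) = 2 := by
  have hne : blk c T ≠ blk c TfA := by
    intro h
    obtain ⟨Q, hQ⟩ := exists_rt_eq_of_blk_eq c h
    revert hQ; revert Q; decide
  have h2 : 2 ≤ Fintype.card (Block c) := Fintype.one_lt_card_iff.mpr ⟨blk c T, blk c TfA, hne⟩
  have h1 := card_block_le_two
  omega

/-- **`φ₂(Q₈, −1) = 2`.** [folklore] -/
theorem fibreTwo_eq_two : fibreTwo c c_mul_c = 2 := le_antisymm fibreTwo_le_two two_le_fibreTwo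

/-- **THE ROW `μ(Q₈, −1) = 2`**: exactly two rank-four face relations are needed and suffice to generate, by base change and together with
the pairs, the integer Hodge lattice of `(Q₈, −1)`. [folklore] -/
theorem isLeast_card_gfaces_generate_two :
    IsLeast {n : ℕ | ∃ S : Finset (CMF G c →₀ ℤ), (↑S ⊆ gfaceSet G c c_mul_c) ∧ S.card = n ∧
      hodgeSpan c c_mul_c ≤ Submodule.span ℤ (pairSet c) ⊔ Submodule.span ℤ (translates c S)} 2 := by
  have h := isLeast_card_gfaces_generate_quaternionEight
  rwa [fibreTwo_eq_two] at h

end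

end Summit.HodgeConjecture.CorCM.Census.QuaternionEight
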